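import Summits.CriticalPhenomena.Ising3DConformalLimit.Theorems.EnergyNotSigmaSquaredGapForcesFarMergingSandwichDefsReg
import Summits.CriticalPhenomena.Ising3DConformalLimit.Theorems.EnergyNotSigmaSquaredGapForcesFarMergingSandwichDoubleSandwich
import Summits.CriticalPhenomena.Ising3DConformalLimit.Theorems.EnergyNotSigmaSquaredGapForcesFarMergingSandwichOnePinchDecay
import Summits.CriticalPhenomena.Ising3DConformalLimit.Theorems.EnergyNotSigmaSquaredGapForcesFarMergingSandwichFarMergingSpins

/-!
# Line `one-cluster-depletion-sandwich` — registered skeleton v5 for crux `GapForcesFarMerging`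
# (item stmt-CriticalPhenomena-4468, route `EnergyNotSigmaSquared`, rank 2) — lead seat c1, end of cycle 1 (2026-08-16)

Crux BY NAME: `Summit.CriticalPhenomena.Ising3DConformalLimit.Theses.EnergyNotSigmaSquared.GapForcesFarMerging`
`= EnergyGapPowerLaw → FarMerging` (`crux_iff`, `Iff.rfl`). Vocabulary: the reviewed Defs modules
`…GapForcesFarMergingSandwichDefs` (p97328 + p106511 + p106687) and `…SandwichDefsReg` (p118908), namespace
`Summit.CriticalPhenomena.Ising3DConformalLimit.GapForcesFarMergingSandwich`.

## State after cycle 1 (everything named here is LANDED unless marked OPEN)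

Two INDEPENDENT duplicated clusters `C = C_{n₁+n₂}(0)` (pair `0, p_K`), `D = C_{n₃+n₄}(e₂)` (pair `e₂, q_K`) in the free box at
`β_c(3)`; `avoid/avoidIn/meet/meetAnn/merge` under `fourTraceLaw`.

* S1 `stub_doubleSandwich` — dup avoidance ≤ two-current avoidance (ADC21 (3.13), finite graphs): p100398.
* S2 `stub_onePinchDecay` — GAP ⇒ `avoid n (pinch K) ≤ C(2^K)^{-κ/2}` at infinitely many doubling `K` (RP minor + energy
  factorisation + box passage + S1): p104198 (+ p100392, p101655).
* S7 `stub_farMergingSpins` — `FarMergeIO → FarMerging` (ADC21 (3.11) in the box + limits): p99692.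
* counting: `octaveCountingReg_of_twoPointDoubling : TwoPointDoubling → OnePinchDecay → HazardDominationReg → FarHitIO` (p119883;
  near-pinch floor p103345, far tail p105708, planner-form counting p105714/p102781, all-octave form p117106).
* glue: `hazardDominationReg_of_AD_MD : AvoidanceDomination → MeetDominationReg → HazardDominationReg` (DefsReg, p118908).
* OPEN `stub_avoidanceDomination` (AD; lead; API p119780 avoidance tilt `ρ_X(C)²`, antitone) — un-conditioning at every octave `k ≤ 5K+3`.
* OPEN `stub_meetDominationReg` (MD′; helpers p111921 same-point re-rooting at measure level, p112570 first moment, p112132 doubling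
  abundance, p119419 `1/N` identity + reduction to the re-rooted domination RD; open core H2 = multiplicative far-endpoint relocation for
  four independent sourced currents through a common vertex, at a doubling octave).
* OPEN `stub_octaveCountingReg : OnePinchDecay → HazardDominationReg → FarHitIO` — `stub-blocked: TwoPointDoubling` (EXISTING item
  stmt-CriticalPhenomena-6150, route `MirrorHoelderCompactness`); the conditional form is the landed p119883.
* OPEN `stub_fourToTwoMerging : FarHitIO → FarMergeIO` — `stub-blocked: LatticeMeetingRobustness`
  (`∀ y inj, ∃ c > 0, ∀ᶠ L, ∀ᶠ n, c * meet n (L•y) ≤ merge n (L•y)`; = crux stmt-CriticalPhenomena-0636's certified heart; dictionary p101750).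

So **crux ⇐ AD ∧ MD′ ∧ TwoPointDoubling (6150) ∧ LMR (0636)**; the composition below is the sorry-free glue.

## Disproof used (`Cruxes/GapForcesFarMerging/Disproof.lean` v13; `Theorems/GapForcesFarMerging/Negative/*`)
`gapForcesFarMerging_false_without_model` / `gapShape_not_determined_by_bulk` honoured: the model enters at AD, MD′, LMR (current-level
couplings of the n.n. model in boxes of `ℤ³`), nothing passes through a scaling limit or the soft package; `cruxWithoutKappaPos_iff`: `κ > 0`
is consumed in the counting (p119883: `C_d ρ^K` vs `λ^{5K}`); no stub is an instance of a landed Negative lemma.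
-/

noncomputable section

namespace Summit.CriticalPhenomena.Ising3DConformalLimit.Cruxes.GapForcesFarMerging.OneClusterDepletionSandwich

open scoped symmDiff ENNReal
open MeasureTheory Filter
open Literature.Probability.LatticeModels Literature.Probability.Percolation
open Summit.CriticalPhenomena.Ising3DConformalLimit.Theses.EnergyNotSigmaSquared
open Summit.CriticalPhenomena.Ising3DConformalLimit.GapForcesFarMergingSandwich
open Summit.CriticalPhenomena.Ising3DConformalLimit.EnergyNotSigmaSquaredGapForcesFarMergingSandwich
  (stub_doubleSandwich stub_onePinchDecay stub_farMergingSpins)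

/-! ## The four registered open stubs (v5) -/

/-- **AD — AVOIDANCE DOMINATION (XL, OPEN; held by the lead).** Un-conditioning: inner avoidance (decreasing in the pair of clusters)
inflates annulus meeting (increasing) by at most a constant `+ ε_k → 0`, at every octave `1 ≤ k ≤ 5K+3`; with `C = 1, ε = 0` it is
Harris' inequality for two decreasing events of the PRODUCT law. Why it might fail: positive association of the duplicated sourced cluster
FAILS in general (4-cycle, route choice), so AD is a genuinely large-scale statement; the Lemma A.1 tilt (landed `avoidanceDomination_tilt`,
p119780: conditional law = `X`-depleted law × `ρ_X(C)²`, `ρ_X` antitone) reduces it to a negative correlation under the depleted law;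
a conditional-Harris route via Lupu–Werner (sourceless double currents are positively associated) leaves a statement about two
independent SINGLE sourced currents. [cite: AizenmanDuminilCopinAnnals2021, Appendix A, Lemma A.1] -/
theorem stub_avoidanceDomination : AvoidanceDomination := by
  sorry

/-- **MD′ — MEET DOMINATION AT A DOUBLING OCTAVE (XL, OPEN).** The unconditional annulus-meeting probability of the one-pinch system
is dominated by fresh duplicated hittings of dilated shapes at comparable scale, at octaves carrying `Doubling θ k`. Landed: exact
re-rooting (p111921), first moment (p112570), abundance (p112132), `1/N` identity + `MD′ ⇐ RD` (p119419). Open core H2. [cite: AizenmanDuminilCopinAnnals2021, §4.1 and §6.2] -/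
theorem stub_meetDominationReg : MeetDominationReg := by
  sorry

/-- **COUNTING AT DOUBLING OCTAVES — blocked on the EXISTING item stmt-CriticalPhenomena-6150 `TwoPointDoubling`.** The landed
`octaveCountingReg_of_twoPointDoubling` (p119883) is this stub with that item as hypothesis (and `…_of_eventualDoubling` with the weaker
`∃ θ > 0, EventualDoubling θ`). [folklore] -/
theorem stub_octaveCountingReg : OnePinchDecay → HazardDominationReg → FarHitIO := by
  sorry

/-- **S6 — FOUR-TO-TWO MERGING (L–XL; OPEN; = crux 0636's heart).** `stub-blocked: LatticeMeetingRobustness`; dictionary p101750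
(also proves the converse `FarMergeIO → FarHitIO`). [cite: AizenmanDuminilCopinAnnals2021, eq. (3.13) and Cor. A.2] -/
theorem stub_fourToTwoMerging : FarHitIO → FarMergeIO := by
  sorry

/-! ## Composition: the stubs and the landed theorems conclude the crux BY NAME -/

/-- **The skeleton theorem (v5)**: the crux BY NAME from the four open stubs and the landed S1, S2, S7, glue. [folklore] -/
theorem GapForcesFarMerging_of :
    Summit.CriticalPhenomena.Ising3DConformalLimit.Theses.EnergyNotSigmaSquared.GapForcesFarMerging :=
  fun hgap => stub_farMergingSpins (stub_fourToTwoMerging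
    (stub_octaveCountingReg (stub_onePinchDecay stub_doubleSandwich hgap)
      (hazardDominationReg_of_AD_MD stub_avoidanceDomination stub_meetDominationReg)))

end Summit.CriticalPhenomena.Ising3DConformalLimit.Cruxes.GapForcesFarMerging.OneClusterDepletionSandwich

end
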